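/-
Origin: expansion seat `planner-pub-hodgecm-mc-axioms-1-g14-0`, handover #W125 2026-08-20T15:53:55Z md5 81b094b0bb65 (PKG 636de999cc46 → 81b094b0bb65; 293 l.; MECHANICAL (iib-R) rewrite v3.1 of the PKG file as it stands (13 token edits; rules R1x1+RX[h₂]x12)) (`HOME/mc/pub-hodgecm-mc-axioms-1-g14/revendor/kit-r55/stage55/HodgeCM/Model/SupplySituation.lean`, md5 81b094b0bb65, 293 lines);
landed by the gen-22 packager (p-g22) in gate run 55 REPLACES the earlier landed copy of `HodgeCM/Model/SupplySituation.lean` (seat copy carried the packager Origin header of an earlier run (stripped)).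
-/
/-
(Θ-sat)/(W1) RE-STAGE DRAFT by `planner-pub-hodgecm-mc-theta-3-g8-0` 2026-08-19 over the installed bytes 5842c000abd5: + Prop field
`ProductKTypeData.sat`, + `situation_isSaturated`, `toSupplySituationAt` fills `SupplySituationAt.sat`; everything else byte-identical.
UNCHECKED (rides RUN 37 with the `Level`-pair root packet; needs the re-staged `ThetaClassInputInstance` with field `KΓ`).
Origin: expansion seat `planner-pub-hodgecm-mc-theta-3-g3-0`, handover #4 2026-08-19T00:44Z md5 fe0ab744cf01ac68e30680a767e6fbe1 (NEW additive leaf, 254 l.; ns HodgeCM.Model (+ .ProductKTypeData); imports HodgeCM.Model.ThetaClassInputInstance (#3) only; structure ProductKTypeData X k N (level Gamma0, finite K-type K2/kappa2 with comm + level, linear archimedean family Phifam through phi_N with (W-Kf) fix + (W-Kinf) arch), ProductKTypeData.kappa (MonoidHom.noncommCopr (`HOME/mc/pub-hodgecm-mc-theta-3-g3/lean/stage/HodgeCM/Model/SupplySituation.lean`, md5 fe0ab744, 254 lines);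
landed by the gen-9 packager (p-g9) in gate run 33 as `HodgeCM/Model/SupplySituation.lean` (verbatim).
-/
/-
Copyright (c) 2026. Released under Apache 2.0 license as described in the file LICENSE.
Cell pub-hodgecm, MODEL layer (construction prover mc-theta-3, gen 3), nodes W6b-Kf / W6b-K∞ / T3-classPacks
of `MODEL-DAG.md`: the product `K`-type situation of the test function `φ_N` and the supply situation it yields.
-/
import Summits.HodgeConjecture.HodgeCM.Model.ThetaClassInputInstance

/-!
# The product `K`-type situation of `φ_N`

`Model/ThetaClassInputInstance` reduces E's `classPacks` to one `SupplySituationAt (X V c) k N` per good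
context, `k ∈ {0,1}`, `N > 0`: a level `Γ₀`, a `K`-type situation `S` of `φ_N`, `fam`, `hol`.  This file
CONSTRUCTS the situation from the shape PerL uses (§4.1–4.2: `φ_N = φ_∞ ⊗ 1_{x₀ + N𝒪̂³}`, `K`-type
`K_∞ × K_f(N)`), leaving as inputs only statements about the pair's Weil action `(X.P k).ω` on an
archimedean FAMILY of test functions through `φ_N`:

* `ProductKTypeData X k N` — a level `Γ₀`; a group `K₂` (`= K_f(N)`) mapped into `G_U(𝔸)` by `κ₂`,
  commuting with the archimedean component `X.ιinf Γ₀ (G₁)` (`comm`), absorbing the level: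
  `∀ δ ∈ X.Δ Γ₀, ∃ m, ιinf δ · κ₂ m ∈ Γ_U` (`level` — the depth of `Γ₀`: `γ_f ∈ K_f(N)` for `γ ∈ Γ₀`);
  a LINEAR archimedean family `Φfam : W^∨ →ₗ 𝒮(𝔸_K^J)` through `φ_N` (`Φfam ℓ₀ = φ_N`, `fam₀`) which is
  FIXED by `ω(κ₂ m, 1)` (`fix`, (W-Kf): `K_f(N) ⊆ Stab φ_{N,f}`) and `K₁`-EQUIVARIANT of type `τ₁^∨`
  (`arch`, (W-K∞): `ω(ιinf κ₁ u, 1) (Φfam ℓ) = Φfam (τ₁^∨(u) ℓ)`);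
* `ProductKTypeData.situation` — the `K`-type situation `Kc := K₁ × K₂`, `κ (u, m) := ιinf (κ₁ u) · κ₂ m`
  (`MonoidHom.noncommCoprod`), `E := W^∨`, `σ := τ₁^∨ ∘ fst`, `τ := τ₁ ∘ fst`, `ι := id`, `η₁ := inl`, with
  `hΔ` (from `level`, `comm`, `c := (1, m)`), `hη`, and the ONE test family `j := Φfam` (read on `ThetaTop`),
  theta-equivariant by `isThetaEquivariant_of_act` from `fix` and `arch` (KERNEL `isThetaEquivariant_family`);
* `ProductKTypeData.toSupplySituationAt B hol` — the supply situation at `φ_N` (`fam` PROVED from `fam₀`),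
  given holomorphy `hol` of the restricted theta forms of the one family (W6b-hol);
* `supplySituationsOf` / `classPacksOf_productKType` — E's `classPacks` (END STATE model,
  `Model.classPacksOf_thetaModelOf`) from one `ProductKTypeData` + `hol` per good sextic context, `k ∈ {0,1}`,
  `N > 0`.

Nothing is cited and nothing is minted: definitions and kernel lemmas over `Model/ThetaClassInputInstance`
and the tree's `ThetaKernelDatum.isThetaEquivariant_of_act`.
-/

set_option autoImplicit false

noncomputable section

open MeasureTheory
open Literature.NumberTheory.Automorphic Literature.NumberTheory.Weil1964
open Literature.NumberTheory.Automorphic.WeightForms (ClassMapDatum thetaClasses restrictHom IsLevelCorrected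
  IsWeightMatched)
open Literature.AlgebraicGeometry.HodgeTheory
open Literature.NumberTheory.Automorphic.PicardCM
open HodgeCM.PerL34.Seesaw HodgeCM.PerL34.RationalCoset HodgeCM.PerL34.SupplyAdelic
open HodgeCM.Model.SupplyInstance HodgeCM.Model.SupplyResidual
open HodgeCM.Model.SupplyResidual.WeilPairData (charInv)
open HodgeCM.Model.ThetaSpace
open scoped Classical

namespace HodgeCM
namespace Model

variable {U : Universe} {Lc : CMField} {ι₁ : Lc →+* ℂ} {V : HermSpace3 Lc ι₁} {c : SeesawCtx Lc}

/-! ### § 1. The data of the product `K`-type of `φ_N` -/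

/-- **Product `K`-type data at `φ_N`** for the input `X`, type index `k`: the level `Γ₀`, the finite part
`K₂ → G_U(𝔸)` of the `K`-type (commuting with the archimedean component, absorbing the level), and a linear
archimedean family of test functions through `φ_N`, fixed by `K₂` and `K₁`-equivariant of type `τ₁^∨`
under the pair's Weil action. -/
structure ProductKTypeData (X : ThetaSpaceInput U V c) (k : Fin 4) (N : ℕ) : Type 1 where
  /-- the level at which the classes are supplied -/
  Γ₀ : Level V
  /-- the finite part `K_f(N)` of the `K`-type -/
  K₂ : Type
  [instK₂ : Group K₂]
  /-- its map to `G_U(𝔸)` -/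
  κ₂ : K₂ →* X.GU
  /-- it commutes with the archimedean component -/
  comm : ∀ (m : K₂) (x : X.G₁), Commute (κ₂ m) (X.ιinf Γ₀ x)
  /-- it absorbs the level: `γ_f ∈ K_f(N)` for `γ ∈ Γ₀` -/
  level : ∀ δ ∈ X.Δ Γ₀, ∃ m : K₂, X.ιinf Γ₀ δ * κ₂ m ∈ (X.P k).ΓU
  /-- saturation ((Θ-sat)): every element of the compact open `K_{Γ₀}` of the level, placed in `G_U(𝔸)`, is an
  index element -/
  sat : ∀ g ∈ X.KΓ Γ₀, ∃ m : K₂, κ₂ m = g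
  /-- the archimedean family of test functions at level `N` (`ℓ ↦ Φ_∞(ℓ) ⊗ 1_{x₀ + N𝒪̂}`) -/
  Φfam : Module.Dual ℂ X.W →ₗ[ℂ] piSchwartzBruhat X.K X.J
  /-- the covector at which the family passes through `φ_N` -/
  ℓ₀ : Module.Dual ℂ X.W
  /-- `Φfam ℓ₀ = φ_N` -/
  fam₀ : Φfam ℓ₀ = testFun X.K X.J (X.P k).Φinf (X.P k).x₀ N
  /-- (W-Kf) the finite part of the `K`-type fixes the family -/
  fix : ∀ (m : K₂) (ℓ : Module.Dual ℂ X.W), (X.P k).ω (κ₂ m, 1) (Φfam ℓ) = Φfam ℓ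
  /-- (W-K∞) the family is `K₁`-equivariant of type `τ₁^∨` -/
  arch : ∀ (u : X.K₁) (ℓ : Module.Dual ℂ X.W),
    (X.P k).ω (X.ιinf Γ₀ (X.κ₁ u), 1) (Φfam ℓ) = Φfam (X.τ₁.dual u ℓ)

attribute [instance] ProductKTypeData.instK₂

namespace ProductKTypeData

variable {X : ThetaSpaceInput U V c} {k : Fin 4} {N : ℕ} (B : ProductKTypeData X k N)

/-- The `K`-type map `κ (u, m) := ιinf (κ₁ u) · κ₂ m`. -/
def kappa : X.K₁ × B.K₂ →* X.GU :=
  ((X.ιinf B.Γ₀).comp X.κ₁).noncommCoprod B.κ₂ fun u m => (B.comm m (X.κ₁ u)).symm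

/-- (Ported verbatim from the HodgeCMPerL package; no docstring in the source.) -/
@[simp] theorem kappa_apply (u : X.K₁) (m : B.K₂) : B.kappa (u, m) = X.ιinf B.Γ₀ (X.κ₁ u) * B.κ₂ m := rfl

/-- The weight `τ := τ₁ ∘ fst` (trivial on the finite part). -/
def tau : Representation ℂ (X.K₁ × B.K₂) X.W := X.τ₁.comp (MonoidHom.fst X.K₁ B.K₂)

/-- (Ported verbatim from the HodgeCMPerL package; no docstring in the source.) -/
@[simp] theorem tau_apply (u : X.K₁) (m : B.K₂) : B.tau (u, m) = X.τ₁ u := rfl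

/-- The `K`-type `σ := τ₁^∨ ∘ fst` on `E := W^∨`. -/
def sigma : Representation ℂ (X.K₁ × B.K₂) (Module.Dual ℂ X.W) := X.τ₁.dual.comp (MonoidHom.fst X.K₁ B.K₂)

/-- (Ported verbatim from the HodgeCMPerL package; no docstring in the source.) -/
@[simp] theorem sigma_apply (u : X.K₁) (m : B.K₂) : B.sigma (u, m) = X.τ₁.dual u := rfl

/-- (Ported verbatim from the HodgeCMPerL package; no docstring in the source.) -/
theorem tau_dual_apply (x : X.K₁ × B.K₂) (ℓ : Module.Dual ℂ X.W) : B.tau.dual x ℓ = B.sigma x ℓ := by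
  obtain ⟨u, m⟩ := x
  simp [Representation.dual_apply, tau, sigma]

/-- The one test family, read on the `Θ`-initial carrier. -/
def jFam : Module.Dual ℂ X.W →ₗ[ℂ] (X.P k).weilDatum.ThetaTop := B.Φfam

/-- (Ported verbatim from the HodgeCMPerL package; no docstring in the source.) -/
theorem jFam_apply (ℓ : Module.Dual ℂ X.W) : B.jFam ℓ = (X.P k).weilDatum.toThetaTop (B.Φfam ℓ) := rfl

/-- **KERNEL (W-Kf) + (W-K∞) ⇒ the family intertwines `σ` with the Weil ACTION `s(κ ·, 1)` ON THE NOSE**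
(the hypothesis of the tree's `ThetaKernelDatum.isThetaEquivariant_of_act`; (SS-K) exit (X1): the supplied
situation is STRICT, `situation_isStrict`). -/
theorem act_family (x : X.K₁ × B.K₂) (ℓ : Module.Dual ℂ X.W) :
    B.jFam (B.sigma x ℓ) =
      (X.P k).kernelDatum.W.act ((X.P k).kernelDatum.s (B.kappa x, 1)) (B.jFam ℓ) := by
  obtain ⟨u, m⟩ := x
  change B.Φfam (X.τ₁.dual u ℓ) = (X.P k).ω (X.ιinf B.Γ₀ (X.κ₁ u) * B.κ₂ m, 1) (B.Φfam ℓ)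
  have hmul : ((X.ιinf B.Γ₀ (X.κ₁ u) * B.κ₂ m, 1) : X.GU × relNormOneIdeles X.K X.L) =
      (X.ιinf B.Γ₀ (X.κ₁ u), 1) * (B.κ₂ m, 1) := by
    simp [Prod.mk_mul_mk]
  rw [hmul, map_mul, Module.End.mul_apply, B.fix, B.arch]

/-- **KERNEL (W-Kf) + (W-K∞) ⇒ theta-equivariance of the family** through `κ` and `σ`. -/
theorem isThetaEquivariant_family : (X.P k).kernelDatum.IsThetaEquivariant B.kappa B.sigma B.jFam :=
  (X.P k).kernelDatum.isThetaEquivariant_of_act B.act_family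

/-- Level correction of the product `K`-type (`c := (1, m)` with `m` from `level`). -/
theorem isLevelCorrected : IsLevelCorrected (X.P k).ΓU B.kappa B.tau (X.ιinf B.Γ₀) (X.Δ B.Γ₀) := by
  intro δ hδ
  obtain ⟨m, hm⟩ := B.level δ hδ
  refine ⟨(1, m), by simp, by simpa using hm, fun x => ?_⟩
  simpa using B.comm m x

/-- Weight matching of the product `K`-type (`η₁ := inl`). -/
theorem isWeightMatched :
    IsWeightMatched B.kappa B.tau (X.ιinf B.Γ₀) X.κ₁ X.τ₁ (MonoidHom.inl X.K₁ B.K₂) :=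
  ⟨fun u => by simp, fun _ => rfl⟩

/-- **The `K`-type situation of `φ_N`** built from the product data. -/
def situation : KTypeSituation (X.P k) (X.ιinf B.Γ₀) (X.Δ B.Γ₀) X.κ₁ X.τ₁ where
  Kc := X.K₁ × B.K₂
  κ := B.kappa
  E := Module.Dual ℂ X.W
  σ := B.sigma
  τ := B.tau
  ι := LinearMap.id
  hι := B.tau_dual_apply
  η₁ := MonoidHom.inl X.K₁ B.K₂
  hΔ := B.isLevelCorrected
  hη := B.isWeightMatched
  𝓙 := {⟨B.jFam, B.isThetaEquivariant_family⟩}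

/-- (Ported verbatim from the HodgeCMPerL package; no docstring in the source.) -/
@[simp] theorem situation_𝓙 :
    B.situation.𝓙 = {⟨B.jFam, B.isThetaEquivariant_family⟩} := rfl

/-- The product situation is SATURATED at `K_{Γ₀}`: index `(1, m)`, weight `τ₁ 1 = 1` ((Θ-sat)). -/
theorem situation_isSaturated : B.situation.IsSaturated (X.KΓ B.Γ₀) := fun g hg => by
  obtain ⟨m, hm⟩ := B.sat g hg
  refine ⟨(1, m), ?_, ?_⟩
  · change B.kappa (1, m) = g
    rw [kappa_apply, map_one, map_one, one_mul, hm]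
  · change B.tau (1, m) = 1
    rw [tau_apply, map_one]

/-- The product situation is STRICT ((SS-K) exit (X1)): its one family acts on the nose (`act_family`). -/
theorem situation_isStrict : B.situation.IsStrict := by
  intro j hj c e
  rw [situation_𝓙, Set.mem_singleton_iff] at hj
  subst hj
  exact B.act_family c e

/-- `φ_N` lies in the family (`fam` of the supply situation). -/
theorem fam : ∃ j ∈ B.situation.𝓙, ∃ ℓ : Module.Dual ℂ X.W, j.1 (B.situation.ι ℓ) = (X.P k).testFunT N :=
  ⟨⟨B.jFam, B.isThetaEquivariant_family⟩, rfl, B.ℓ₀, by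
    change B.Φfam B.ℓ₀ = _
    rw [B.fam₀]; rfl⟩

/-- The restricted theta form of the one family against a weight function `f`. -/
def restrictedThetaForm (f : C(relNormOneIdeles X.K X.L ⧸ relNormOneRat X.K X.L, ℂ)) :
    weightForms (X.Δ B.Γ₀) X.κ₁ X.τ₁ :=
  restrictHom (X.ιinf B.Γ₀) B.isLevelCorrected B.isWeightMatched
    ((X.P k).kernelDatum.thetaForm (probHaarRelNormOneQuot X.K X.L) (X.P k).kernelDatum_thetaLinear B.kappa
      B.jFam B.isThetaEquivariant_family LinearMap.id B.tau_dual_apply f)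

/-- **The supply situation at `φ_N`** from the product data and holomorphy of the restricted theta forms of
the one family (W6b-hol). -/
def toSupplySituationAt
    (hol : ∀ f ∈ (X.P k).weightFunctions, B.restrictedThetaForm f ∈ (X.D B.Γ₀).Hol) :
    SupplySituationAt X k N where
  Γ₀ := B.Γ₀
  S := B.situation
  fam := B.fam
  sat := B.situation_isSaturated
  strict := B.situation_isStrict
  hol := by
    rintro j hj f hf
    rw [situation_𝓙, Set.mem_singleton_iff] at hj
    subst hj
    exact hol f hf

end ProductKTypeData

/-! ### § 2. E's `classPacks` from product `K`-type data -/

section Producer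

variable (X : ∀ {Lc : CMField} {ι₁ : Lc →+* ℂ} (V : HermSpace3 Lc ι₁) (c : SeesawCtx Lc), ThetaSpaceInput U V c)

/-- Supply situations from product `K`-type data with holomorphy, per good context of a theta model `T`. -/
def supplySituationsOf (T : U.ThetaModel)
    (B : ∀ {Lc : CMField} {ι₁ : Lc →+* ℂ} (V : HermSpace3 Lc ι₁) (c : SeesawCtx Lc), T.GoodCtx ι₁ c →
      Module.finrank ℚ c.K = 6 → ∀ k : Fin 4, k = 0 ∨ k = 1 → ∀ N : ℕ, 0 < N → ProductKTypeData (X V c) k N)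
    (hol : ∀ {Lc : CMField} {ι₁ : Lc →+* ℂ} (V : HermSpace3 Lc ι₁) (c : SeesawCtx Lc) (hc : T.GoodCtx ι₁ c)
      (h6 : Module.finrank ℚ c.K = 6) (k : Fin 4) (hk : k = 0 ∨ k = 1) (N : ℕ) (hN : 0 < N),
      ∀ f ∈ ((X V c).P k).weightFunctions,
        (B V c hc h6 k hk N hN).restrictedThetaForm f ∈ ((X V c).D (B V c hc h6 k hk N hN).Γ₀).Hol)
    {Lc : CMField} {ι₁ : Lc →+* ℂ} (V : HermSpace3 Lc ι₁) (c : SeesawCtx Lc) (hc : T.GoodCtx ι₁ c)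
    (h6 : Module.finrank ℚ c.K = 6) (k : Fin 4) (hk : k = 0 ∨ k = 1) (N : ℕ) (hN : 0 < N) :
    SupplySituationAt (X V c) k N :=
  (B V c hc h6 k hk N hN).toSupplySituationAt (hol V c hc h6 k hk N hN)

end Producer

section EndState

variable (hHD : exists_isReal_hodgeModel) (hI : hodgePQ_independent_of_hodgeModel)
  (h₁ : BallQuotientUniformised)  (h₃ : CMAbelianVarietyRealised)

/-- **E's `classPacks` at the END STATE's model from product `K`-type data**: one `ProductKTypeData (X V c) k N`
(level, finite `K`-type with (W-Kf), archimedean family with (W-K∞)) and the holomorphy (W6b-hol) of its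
restricted theta forms, per good sextic context, `k ∈ {0,1}`, `N > 0`. -/
theorem classPacksOf_productKType (h : Bool)
    (emb : ∀ {L : CMField} {ι₁ : L →+* ℂ} {V : HermSpace3 L ι₁} (Γ : Level V),
      (picardCMUniverse hHD hI h₁ h₃).CohC ((picardCMUniverse hHD hI h₁ h₃).pms L ι₁ V Γ) 2 →ₗ[ℂ]
        (V.latticeModel printFact_unitaryCompact_holds).toQuotientModel.H)
    (cover : ∀ {L : CMField} {ι₁ : L →+* ℂ} {V : HermSpace3 L ι₁} (Γ Γ' : Level V),
      Γ'.Γ ≤ Γ.Γ → (picardCMUniverse hHD hI h₁ h₃).Mor ((picardCMUniverse hHD hI h₁ h₃).pms L ι₁ V Γ')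
        ((picardCMUniverse hHD hI h₁ h₃).pms L ι₁ V Γ))
    (wm : ∀ {L : CMField} {ι₁ : L →+* ℂ} (V : HermSpace3 L ι₁) (c : SeesawCtx L),
      WeilThetaModel (V.latticeModel printFact_unitaryCompact_holds).toQuotientModel.G
        (V.latticeModel printFact_unitaryCompact_holds).toQuotientModel.Γ
        (c.D.latticeModelW printFact_unitaryCompact_holds).toQuotientModel.G
        (c.D.latticeModelW printFact_unitaryCompact_holds).toQuotientModel.Γ)
    (X : ∀ {L : CMField} {ι₁ : L →+* ℂ} (V : HermSpace3 L ι₁) (c : SeesawCtx L),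
      ThetaSpaceInput (picardCMUniverse hHD hI h₁ h₃) V c)
    (d12 d34 : ∀ {L : CMField}, SeesawCtx L → HodgeCM.Universe.SideData L)
    (B : ∀ {L : CMField} {ι₁ : L →+* ℂ} (V : HermSpace3 L ι₁) (c : SeesawCtx L),
      (thetaModelOf hHD hI h₁ h₃ h emb cover wm (thetaOf _ (thetaClassInputOf _ X)) d12 d34).GoodCtx ι₁ c →
      Module.finrank ℚ c.K = 6 → ∀ k : Fin 4, k = 0 ∨ k = 1 → ∀ N : ℕ, 0 < N → ProductKTypeData (X V c) k N)
    (hol : ∀ {L : CMField} {ι₁ : L →+* ℂ} (V : HermSpace3 L ι₁) (c : SeesawCtx L)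
      (hc : (thetaModelOf hHD hI h₁ h₃ h emb cover wm (thetaOf _ (thetaClassInputOf _ X)) d12 d34).GoodCtx
        ι₁ c)
      (h6 : Module.finrank ℚ c.K = 6) (k : Fin 4) (hk : k = 0 ∨ k = 1) (N : ℕ) (hN : 0 < N),
      ∀ f ∈ ((X V c).P k).weightFunctions,
        (B V c hc h6 k hk N hN).restrictedThetaForm f ∈ ((X V c).D (B V c hc h6 k hk N hN).Γ₀).Hol)
    {L : CMField} {ι₁ : L →+* ℂ} (V : HermSpace3 L ι₁) (c : SeesawCtx L)
    (hc : (thetaModelOf hHD hI h₁ h₃ h emb cover wm (thetaOf _ (thetaClassInputOf _ X)) d12 d34).GoodCtx ι₁ c)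
    (h6 : Module.finrank ℚ c.K = 6) :
    Nonempty (ClassSupplyPackN
        (thetaModelOf hHD hI h₁ h₃ h emb cover wm (thetaOf _ (thetaClassInputOf _ X)) d12 d34) V c 0) ∧
      Nonempty (ClassSupplyPackN
        (thetaModelOf hHD hI h₁ h₃ h emb cover wm (thetaOf _ (thetaClassInputOf _ X)) d12 d34) V c 1) :=
  classPacksOf_thetaModelOf hHD hI h₁ h₃ h emb cover wm X d12 d34 (supplySituationsOf X _ B hol) V c hc h6

end EndState

end Model
end HodgeCM

end
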